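import Summits.QuantumAdvantage.AdviceFreeQNC0.RingHardOdd
import Summits.QuantumAdvantage.QuantumAdvantage.Theorems.RingFrameBridge
import HarnessLib
import HarnessLib.Audit.Tags

/-!
# Rung leaf F-Q2-odd3 (cell qa-qnc0, seat p1): advice-free `QNC⁰ ⊄ FAC⁰[3]` — STATEMENT ONLY

Planner qa-qnc0-p1 g17 (D-0145 registration of the `p = 3` line). This module ASSERTS NOTHING: it names the
rung leaf the route `DWalkThree` (sub `QuantumAdvantage/QuantumAdvantage`, ledger
`route-QuantumAdvantage-DWalkThree`) concludes BY NAME, `AdviceFreeQNC0Three : Prop := AdviceFreeQNC0Sep 3`,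
tagged `@[conjecture]` (an obligation node, provable / refutable by name, never a vendored fact), exactly as the
F-Q1 leaf `AdviceFreeQNC0 := AdviceFreeQNC0Sep 2` (`AdviceFreeQNC0.lean`) and the odd-prime leaf
`AdviceFreeQNC0Odd := ∀ p ≥ 5 prime, AdviceFreeQNC0Sep p` (`AdviceFreeQNC0Odd.lean`).  `p = 3` is the prime the
u-walk instrument cannot serve (`not_walkHardF_three`); the D-walk line attacks it through the cycle-HLF relation on
the odd class, whose landed bridge is `adviceFreeQNC0Sep_of_ringHard 3 ∘ ringHardOfOdd 3 : RingHardOdd 3 → …`.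
Honesty label: rung F-Q2-odd (p = 3), not BQP ⊄ BPP; PRINTED-OPEN (WKST19 §1.3, GK24 §1.3: separations against
`AC⁰[p]` without advice / for composite or odd prime moduli are open beyond `p = 2`).
-/

namespace Summit.QuantumAdvantage.AdviceFreeQNC0

/-- **Rung leaf F-Q2-odd3** (closed `Prop`, alt-closer candidate of `QuantumAdvantage/QuantumAdvantage`): some
polynomially-bounded relation family is solved with certainty by advice-free `QNC⁰` and is `θ`-hard (`θ < 1`) for
`FAC⁰[3]` circuit tuples with uniform shared randomness. PRINTED-OPEN (WKST19 §1.3, GK24 §1.3). -/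
@[conjecture] def AdviceFreeQNC0Three : Prop := AdviceFreeQNC0Sep 3

/-- Unfolding lemma: the leaf is literally `AdviceFreeQNC0Sep 3`. [bookkeeping] -/
theorem adviceFreeQNC0Three_iff : AdviceFreeQNC0Three ↔ AdviceFreeQNC0Sep 3 := Iff.rfl

/-- The route's load-bearing statement decides the leaf: `RingHardOdd 3 → AdviceFreeQNC0Three`
(landed bridge: give away the even class, then the ring-frame bridge). -/
theorem adviceFreeQNC0Three_of_ringHardOdd (h : RingHardOdd 3) : AdviceFreeQNC0Three :=
  Summit.QuantumAdvantage.QuantumAdvantage.Theorems.adviceFreeQNC0Sep_of_ringHard 3 (ringHardOfOdd 3 h)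

end Summit.QuantumAdvantage.AdviceFreeQNC0
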